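import Summits.FinalStateConjecture.FinalStateConjecture.Theorems.SwallowTheDatumKerrShieldedSettlesStubExteriorTransport
import HarnessLib

set_option linter.dupNamespace false

/-!
# Stub `stub_exteriorLastExit` (T5) of line `swallow-transfer`, crux `EIHFluxBalance.ModulatedKerrHandoff` (stmt-FinalStateConjecture-10167)

Support file for crux `stmt-FinalStateConjecture-10167`
(`Summit.FinalStateConjecture.FinalStateConjecture.Theses.EIHFluxBalance.ModulatedKerrHandoff`), line
`swallow-transfer`: the registered stub `stub_exteriorLastExit` (statement VERBATIM from the registered skeleton
`Cruxes/ModulatedKerrHandoff/Lines/swallow_transfer.lean`).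

**The last-exit inclusion.** For a Kerr-shielded datum (sub-extremal `(M, a)`, window `r₋ < r₁ < r₊`, `ψ` the graph
of the leaf height `T = bentHeight M a` over the Kerr–Schild slice), ANY vacuum Cauchy development `𝒟` of `D` and a
chart map `χ : Kerr.region a r₁ → 𝒟` which on the tapered collar `W = {0 < x⁰ − T(r) + (r − r₁)/4}` is smooth, an
open embedding, isometric and oriented, with `χ ∘ ψ = ι ∘ φ` on the leaf, the reverse inclusion
`J⁺(ιX) ∩ I⁻(χ(O_K)) ⊆ χ(O_K)`, `O_K = {r > r₊, x⁰ ≥ T(r)}`, holds.  This is a corollary of the LANDED last-exit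
argument `ExteriorTransport.mem_image_of_lastExit` of crux `stmt-FinalStateConjecture-10054` (line
`tapered-temporal-collar`, stub S7, file `Theorems/SwallowTheDatumKerrShieldedSettlesStubExteriorTransportAuxLift.lean`),
run in `𝒟` with its Cauchy hypersurface `ιX = range 𝒟.embed` (`VacuumCauchyDevelopment.isCauchyHypersurface`): the
leaf points `ψ y = graph T y` are mapped into `ιX` because `χ ∘ ψ = ι ∘ φ`, and `I⁻` of a set is the union of the
`I⁻` of its points (`LorentzianMetric.chronologicalFuture_eq_biUnion`, time-dually).

References: B. O'Neill, *Semi-Riemannian geometry* (1983), Ch. 14, p. 402, Cor. 14.1, Lemma 14.29; M. Dafermos,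
I. Rodnianski, arXiv:0811.0354, §5.1.
-/

noncomputable section

open Set Filter Function
open scoped Manifold ContDiff Topology
open Literature.Geometry.Lorentzian
open Summit.FinalStateConjecture.FinalStateConjecture.Theorems.KerrShieldedDataExist.Negative
  (bentHeight graph psi_eq_graph)
open Summit.FinalStateConjecture.FinalStateConjecture.Theorems.SwallowTheDatum.KerrShieldedSettles.ExteriorTransport
  (mem_image_of_lastExit)
open Summit.FinalStateConjecture.FinalStateConjecture.Theorems.SwallowTheDatum.KerrShieldedSettles.CollarEmbedsMGHD
  (exists_graph_eq_iff)

namespace Summit.FinalStateConjecture.FinalStateConjecture.Cruxes.ModulatedKerrHandoff.SwallowTransfer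

/-- **T5 `stub_exteriorLastExit` — the last-exit inclusion `J⁺(ιX) ∩ I⁻(χ(O_K)) ⊆ χ(O_K)`.**  For a shielded datum
(sub-extremal `(M, a)`, `r₋ < r₁ < r₊`, `ψ` the graph of `T = bentHeight M a`), ANY vacuum Cauchy development `𝒟` of
`D` and a chart map `χ` smooth / open embedding / isometric / oriented on the tapered collar
`W = {0 < x⁰ − T(r) + (r − r₁)/4}` with `χ ∘ ψ = ι ∘ φ`: every point of `J⁺(ιX)` in the chronological past of
`χ(O_K)`, `O_K = {r > r₊, x⁰ ≥ T(r)}`, lies in `χ(O_K)`.  Proof: `ψ = graph T` (`psi_eq_graph`), so the `χ`-image of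
every leaf point `{x⁰ = T(r x)}` (`exists_graph_eq_iff`) is `ι(φ y) ∈ ιX`; `I⁻(χ(O_K)) = ⋃_{c ∈ O_K} I⁻(χ c)`
(`chronologicalFuture_eq_biUnion` for the reversed orientation); for `q ∈ J⁺(ιX) ∩ I⁻(χ c)` the LAST-EXIT ARGUMENT
`ExteriorTransport.mem_image_of_lastExit` (crux 10054, stub S7) with the Cauchy hypersurface `ιX` of `𝒟`
(`VacuumCauchyDevelopment.isCauchyHypersurface`) gives `q ∈ χ(O_K)`.  O'Neill 1983, Ch. 14, p. 402, Cor. 14.1 and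
Lemma 14.29; Dafermos–Rodnianski arXiv:0811.0354, §5.1. -/
theorem stub_exteriorLastExit : ∀ [Kerr.Facts] (X : Type) [TopologicalSpace X] [ChartedSpace E3 X]
    [IsManifold (𝓡 3) ((⊤ : ℕ∞) : WithTop ℕ∞) X] [T2Space X] [SecondCountableTopology X] [ConnectedSpace X]
    (D : InitialDataSet (𝓡 3) X) (M a r₁ : ℝ) (hM : 0 ≤ M) (φ : Kerr.slice a r₁ → X)
    (ψ : Kerr.slice a r₁ → Kerr.region a r₁),
    |a| < M → Kerr.rMinus M a < r₁ → r₁ < Kerr.rPlus M a →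
    Topology.IsOpenEmbedding φ →
    (∀ y : Kerr.slice a r₁, (ψ y : E4) =
        E4.ofTimeSpace (bentHeight M a (Kerr.radius a (E4.ofTimeSpace 0 (y : E3)))) (y : E3)) →
    ∀ (𝒟 : VacuumCauchyDevelopment D) (χ : Kerr.region a r₁ → 𝒟.carrier),
      ContMDiffOn 𝓘(ℝ, E4) (𝓡 4) ((⊤ : ℕ∞) : WithTop ℕ∞) χ
          {x : Kerr.region a r₁ | 0 < (x : E4) 0 - bentHeight M a (Kerr.radius a (x : E4)) +
            (Kerr.radius a (x : E4) - r₁) / 4} →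
      Topology.IsOpenEmbedding (Set.restrict
          {x : Kerr.region a r₁ | 0 < (x : E4) 0 - bentHeight M a (Kerr.radius a (x : E4)) +
            (Kerr.radius a (x : E4) - r₁) / 4} χ) →
      (∀ x : Kerr.region a r₁, 0 < (x : E4) 0 - bentHeight M a (Kerr.radius a (x : E4)) +
            (Kerr.radius a (x : E4) - r₁) / 4 →
          (∀ v w : E4, 𝒟.metric.val (χ x) (mfderiv 𝓘(ℝ, E4) (𝓡 4) χ x v)
              (mfderiv 𝓘(ℝ, E4) (𝓡 4) χ x w) = Kerr.bilin M a (x : E4) v w) ∧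
          𝒟.metric.val (χ x) (𝒟.timeOrientation.vectorField (χ x))
              (mfderiv 𝓘(ℝ, E4) (𝓡 4) χ x (Kerr.timeVector M a (x : E4))) < 0) →
      (∀ y : Kerr.slice a r₁, χ (ψ y) = 𝒟.embed (φ y)) →
      𝒟.metric.causalFuture 𝒟.timeOrientation (Set.range 𝒟.embed) ∩
          𝒟.metric.chronologicalPast 𝒟.timeOrientation (χ ''
            {x : Kerr.region a r₁ | Kerr.rPlus M a < Kerr.radius a (x : E4) ∧
            bentHeight M a (Kerr.radius a (x : E4)) ≤ (x : E4) 0}) ⊆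
        χ '' {x : Kerr.region a r₁ | Kerr.rPlus M a < Kerr.radius a (x : E4) ∧
            bentHeight M a (Kerr.radius a (x : E4)) ≤ (x : E4) 0} := by
  intro _ X _ _ _ _ _ _ D M a r₁ hM φ ψ ha hr₁ hr₂ _ hψ 𝒟 χ hχs hχe hχg hχψ
  obtain rfl : ψ = graph M a r₁ := psi_eq_graph rfl hψ
  -- leaf points of the chart are mapped into the Cauchy hypersurface `ιX`
  have hleaf : ∀ x : Kerr.region a r₁, (x : E4) 0 = bentHeight M a (Kerr.radius a (x : E4)) →
      χ x ∈ range 𝒟.embed := by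
    intro x hx
    obtain ⟨y, rfl⟩ := exists_graph_eq_iff.2 hx
    exact ⟨φ y, (hχψ y).symm⟩
  -- `J⁺(ιX) ∩ I⁻(χ(O_K)) ⊆ χ(O_K)`: the last-exit argument, point by point of `O_K`
  rintro q ⟨hqJ, hqI⟩
  rw [LorentzianMetric.chronologicalPast, LorentzianMetric.chronologicalFuture_eq_biUnion] at hqI
  simp only [mem_iUnion, exists_prop] at hqI
  obtain ⟨p, ⟨c, hc, rfl⟩, hqc⟩ := hqI
  exact mem_image_of_lastExit hM ha hr₁ hr₂ hχs hχe hχg 𝒟.isCauchyHypersurface hleaf hc hqJ hqc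

end Summit.FinalStateConjecture.FinalStateConjecture.Cruxes.ModulatedKerrHandoff.SwallowTransfer

end
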